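import Literature.Analysis.FluidPDE.PineauVicolOneSlice
import Literature.Analysis.FluidPDE.ClassicalSuitableRegion
import Literature.Analysis.FluidPDE.SpaceTimeCalculus
import Literature.Analysis.FluidPDE.TaoEnstrophyIdentity
import Literature.Analysis.FluidPDE.VorticityEquation
import Literature.Analysis.FluidPDE.VorticityStretching
import Literature.Analysis.FluidPDE.VorticityCalculus
import Literature.Analysis.FluidPDE.LipschitzCutoffIBP
import Literature.Analysis.FluidPDE.LeraySelfSimilarCalculus
import Literature.Analysis.FluidPDE.NewtonKernel
import Literature.Analysis.FluidPDE.EnergyUniqueness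
import Mathlib.Analysis.SpecialFunctions.Sqrt
import Mathlib.MeasureTheory.Measure.Haar.NormedSpace
import HarnessLib

/-!
# Pineau–Vicol (2026), Lemma 9.4: the localised enstrophy identity along the self-similar weight

The time-dependent half of the propagation-of-small-vorticity lemma [PineauVicol2026,
Lemma 9.4, (9.8)–(9.9)] behind Theorem 1.9 (`pineauVicol2026_oneSlice_regularity`), for a
classical solution `(u, p)` of Navier–Stokes on the region `[-1,0) × B₁` (`ν = 1`, `f = 0`).

* `isSmoothSpaceTimeOn_cutoff_smul` — the cut-off field `ũ = ζu` (`ζ ∈ C^∞_c(B₁)`) is jointly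
  smooth on `(-1,0) × ℝ³`, so that the slab calculus of `SpaceTimeCalculus` applies;
* `deriv_curl_cutoff_slice_eq` — the vorticity equation `∂ₜω̃ = Δω̃ − (ũ·∇)ω̃ + (ω̃·∇)ũ` of `ũ`
  at the points of `B(0,½)` (where `ζ = 1`), from the momentum equation of `u`
  (Pineau–Vicol (9.8) is its similarity-variable form);
* `hasDerivAt_selfSimilarWeight`, `fderiv_selfSimilarWeight`, `laplacian_selfSimilarWeight` — the
  calculus of the weight `ψ(t,x) = √(−t) η(x/√(−t))` (`η = χ̄(·/R)²`), which is the cut-off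
  `χ²` of (9.9) read in physical variables;
* `integral_inner_laplacian_mul_smooth_weight`, `integral_inner_convect_mul_weight_of_tsupport`
  — the integrations by parts of the viscous and transport terms (after Tao's
  `integral_inner_laplacian_mul_weight`, `integral_inner_convect_mul_weight`, here with a smooth
  weight integrated by parts twice, resp. with `div = 0` only on the support of the weight);
* `hasDerivAt_weightedEnstrophy` — **the identity**: for `t ∈ (−T₁, 0)` with `2R√T₁ ≤ ½`,
  `d/dt ∫ψ|ω̃|² = ∫(∂ₜψ + Δψ + Dψ[ũ])|ω̃|² − 2∫ψ|Dω̃|²_F + 2∫ψ⟨ω̃, Dũ ω̃⟩`;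
* `integral_weight_mul_sq_norm_curl_eq`, `integral_weight_mul_frobeniusNormSq_eq`,
  `integral_weight_mul_stretch_eq`, `integral_weightDeriv_mul_sq_norm_curl_eq` — the substitution
  `x = √(−t) y` turning each term into its similarity-variable form for the profile
  `U(y) = √(−t) ũ(t, √(−t) y)`: `∫ψ|ω̃|² = F² = ∫η|curl U|²`, and `(−t)` times the derivative
  equals `−½F² + E − 2D² + S` in the notation of `PineauVicolSliceEnstrophy` ((9.9)).

## References

* B. Pineau, V. Vicol, *On rotated backwards self-similar solutions of the incompressible 3D
  Navier–Stokes equations*, arXiv:2607.09619 (2026), Lemma 9.4, (9.8)–(9.9), p. 31.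
  [PineauVicol2026]
* T. Tao, *Localisation and compactness properties of the Navier–Stokes global regularity
  problem*, Anal. PDE 6 (2013), §10, proof of Thm. 10.1. [Tao2011]
-/
noncomputable section

open MeasureTheory Set Function Filter Metric TopologicalSpace InnerProductSpace
open _root_.Topology
open scoped ENNReal NNReal InnerProductSpace RealInnerProductSpace Laplacian ContDiff

namespace Literature.Analysis.FluidPDE

section RegionCutoff

-- nested operator types
set_option maxSynthPendingDepth 3

variable {F : Type*} [NormedAddCommGroup F] [NormedSpace ℝ F]

/-- **A region-smooth field times a spatial cut-off is jointly smooth on the open time interval.**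
For `w` jointly smooth on `[-1,0) × B₁` and `ζ ∈ C^∞` with `supp ζ ⊆ B₁`, the field
`(t, x) ↦ ζ(x) w(t, x)` is jointly smooth on `(-1, 0) × ℝ³`. [folklore] -/
theorem isSmoothSpaceTimeOn_cutoff_smul {w : ℝ → EuclideanSpace ℝ (Fin 3) → F}
    (hw : ContDiffOn ℝ ∞ (uncurry w) (Ico (-1 : ℝ) 0 ×ˢ ball (0 : EuclideanSpace ℝ (Fin 3)) 1))
    {ζ : EuclideanSpace ℝ (Fin 3) → ℝ} (hζ : ContDiff ℝ ∞ ζ)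
    (hζs : tsupport ζ ⊆ ball (0 : EuclideanSpace ℝ (Fin 3)) 1) :
    IsSmoothSpaceTimeOn (Ioo (-1 : ℝ) 0) (fun t x => ζ x • w t x) := by
  intro z hz
  have e : uncurry (fun t x => ζ x • w t x) = fun z : ℝ × EuclideanSpace ℝ (Fin 3) => ζ z.2 • uncurry w z := by
    funext z; rfl
  rw [e]
  obtain ⟨t, x⟩ := z
  have ht : t ∈ Ioo (-1 : ℝ) 0 := (mem_prod.1 hz).1
  by_cases hx : x ∈ ball (0 : EuclideanSpace ℝ (Fin 3)) 1
  · have hO : IsOpen (Ioo (-1 : ℝ) 0 ×ˢ ball (0 : EuclideanSpace ℝ (Fin 3)) 1) := isOpen_Ioo.prod isOpen_ball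
    have hwat : ContDiffAt ℝ ∞ (uncurry w) (t, x) :=
      (hw.mono (prod_mono Ioo_subset_Ico_self Subset.rfl)).contDiffAt (hO.mem_nhds (mk_mem_prod ht hx))
    exact ((hζ.contDiffAt.comp (t, x) contDiffAt_snd).smul hwat).contDiffWithinAt
  · have hx0 : ζ =ᶠ[𝓝 x] 0 := notMem_tsupport_iff_eventuallyEq.1 fun h => hx (hζs h)
    have hz0 : (fun z : ℝ × EuclideanSpace ℝ (Fin 3) => ζ z.2 • uncurry w z) =ᶠ[𝓝 (t, x)] fun _ => 0 := by
      have h2 : ∀ᶠ z : ℝ × EuclideanSpace ℝ (Fin 3) in 𝓝 (t, x), ζ z.2 = 0 :=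
        (continuous_snd.tendsto (t, x)).eventually hx0
      filter_upwards [h2] with z hz
      rw [hz, zero_smul]
    exact (contDiffAt_const.congr_of_eventuallyEq hz0).contDiffWithinAt

/-- Near a point where the cut-off is `1`, the cut-off field agrees with the field, slice by
slice. [folklore] -/
theorem cutoff_smul_slice_eventuallyEq {w : ℝ → EuclideanSpace ℝ (Fin 3) → F}
    {ζ : EuclideanSpace ℝ (Fin 3) → ℝ} {x : EuclideanSpace ℝ (Fin 3)} (hζ1 : ζ =ᶠ[𝓝 x] fun _ => 1)
    (t : ℝ) : (fun y => ζ y • w t y) =ᶠ[𝓝 x] w t := by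
  filter_upwards [hζ1] with y hy
  rw [hy, one_smul]

end RegionCutoff

section PsiCalculus

-- nested operator types
set_option maxSynthPendingDepth 3

variable {η : EuclideanSpace ℝ (Fin 3) → ℝ}

/-- **Time derivative of the self-similar weight** `ψ(t, x) = √(−t) η(x/√(−t))`, `t < 0`:
`∂ₜψ = −(1/(2c)) (η(y) − Dη(y)[y])`, `c = √(−t)`, `y = x/c`. [folklore] -/
theorem hasDerivAt_selfSimilarWeight (hη : Differentiable ℝ η) {t : ℝ} (ht : t < 0)
    (x : EuclideanSpace ℝ (Fin 3)) :
    HasDerivAt (fun s => Real.sqrt (-s) * η ((Real.sqrt (-s))⁻¹ • x))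
      (-(1 / (2 * Real.sqrt (-t))) *
        (η ((Real.sqrt (-t))⁻¹ • x) -
          fderiv ℝ η ((Real.sqrt (-t))⁻¹ • x) ((Real.sqrt (-t))⁻¹ • x))) t := by
  set c : ℝ := Real.sqrt (-t) with hc_def
  have hc : 0 < c := Real.sqrt_pos.2 (by linarith)
  -- `d/ds √(−s) = −1/(2c)`
  have h1 : HasDerivAt (fun s => Real.sqrt (-s)) (-(1 / (2 * c))) t := by
    have h := (Real.hasDerivAt_sqrt (by linarith : (-t) ≠ 0)).comp t (hasDerivAt_neg t)
    have e : 1 / (2 * Real.sqrt (-t)) * -1 = -(1 / (2 * c)) := by rw [hc_def]; ring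
    rw [← e]
    exact h
  -- `d/ds (√(−s))⁻¹ = 1/(2c³)`
  have h2 : HasDerivAt (fun s => (Real.sqrt (-s))⁻¹) (1 / (2 * c ^ 3)) t := by
    have h := h1.inv hc.ne'
    refine h.congr_deriv ?_
    rw [← hc_def]
    field_simp
  have h3 : HasDerivAt (fun s => (Real.sqrt (-s))⁻¹ • x) ((1 / (2 * c ^ 3)) • x) t := h2.smul_const x
  have h4 : HasDerivAt (fun s => η ((Real.sqrt (-s))⁻¹ • x))
      (fderiv ℝ η (c⁻¹ • x) ((1 / (2 * c ^ 3)) • x)) t :=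
    (hη (c⁻¹ • x)).hasFDerivAt.comp_hasDerivAt t h3
  have h5 := h1.mul h4
  -- `x = c • (c⁻¹ • x)` inside `Dη`
  have ex : fderiv ℝ η (c⁻¹ • x) x = c * fderiv ℝ η (c⁻¹ • x) (c⁻¹ • x) := by
    rw [← smul_eq_mul, ← map_smul, smul_smul, mul_inv_cancel₀ hc.ne', one_smul]
  refine h5.congr_deriv ?_
  rw [map_smul, smul_eq_mul, ex]
  show -(1 / (2 * c)) * η (c⁻¹ • x) + c * (1 / (2 * c ^ 3) * (c * fderiv ℝ η (c⁻¹ • x) (c⁻¹ • x))) =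
    -(1 / (2 * c)) * (η (c⁻¹ • x) - fderiv ℝ η (c⁻¹ • x) (c⁻¹ • x))
  field_simp
  ring

/-- **Spatial derivative of the weight**: `Dₓ(c η(c⁻¹ ·))(x) = Dη(c⁻¹x)` for `c ≠ 0`. [folklore] -/
theorem fderiv_selfSimilarWeight {c : ℝ} (hc : c ≠ 0) (x : EuclideanSpace ℝ (Fin 3)) :
    fderiv ℝ (fun z => c * η (c⁻¹ • z)) x = fderiv ℝ η (c⁻¹ • x) := by
  have h := fderiv_const_smul_comp_smul' η c c⁻¹ x
  simp only [smul_eq_mul] at h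
  rw [h, mul_inv_cancel₀ hc, one_smul]

/-- **Laplacian of the weight**: `Δₓ(c η(c⁻¹ ·))(x) = c⁻¹ (Δη)(c⁻¹x)` for `c ≠ 0`, `η ∈ C²`. [folklore] -/
theorem laplacian_selfSimilarWeight (hη : ContDiff ℝ 2 η) {c : ℝ} (hc : c ≠ 0)
    (x : EuclideanSpace ℝ (Fin 3)) :
    (Δ (fun z => c * η (c⁻¹ • z))) x = c⁻¹ * (Δ η) (c⁻¹ • x) := by
  have e : (fun z : EuclideanSpace ℝ (Fin 3) => c * η (c⁻¹ • z)) =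
      (c * c) • fun z => c⁻¹ • η (c⁻¹ • z) := by
    funext z
    simp only [Pi.smul_apply, smul_eq_mul]
    field_simp
  have hg : ContDiff ℝ 2 fun z : EuclideanSpace ℝ (Fin 3) => c⁻¹ • η (c⁻¹ • z) :=
    (hη.comp (contDiff_const_smul _)).const_smul _
  rw [e, InnerProductSpace.laplacian_smul _ hg.contDiffAt, laplacian_smul_comp_smul hη c⁻¹ x]
  simp only [smul_eq_mul]
  field_simp

/-- **Joint smoothness of the weight** on negative times. [folklore] -/
theorem isSmoothSpaceTimeOn_selfSimilarWeight (hη : ContDiff ℝ ∞ η) {S : Set ℝ} (hS : S ⊆ Iio 0) :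
    IsSmoothSpaceTimeOn S fun t x => Real.sqrt (-t) * η ((Real.sqrt (-t))⁻¹ • x) := by
  intro z hz
  obtain ⟨t, x⟩ := z
  have ht : t < 0 := hS (mem_prod.1 hz).1
  have hsq : ContDiffAt ℝ ∞ (fun z : ℝ × EuclideanSpace ℝ (Fin 3) => Real.sqrt (-z.1)) (t, x) :=
    (Real.contDiffAt_sqrt (by simp; linarith)).comp (t, x) contDiffAt_fst.neg
  have hne : Real.sqrt (-t) ≠ 0 := (Real.sqrt_pos.2 (by linarith)).ne'
  have hinv : ContDiffAt ℝ ∞ (fun z : ℝ × EuclideanSpace ℝ (Fin 3) => (Real.sqrt (-z.1))⁻¹) (t, x) :=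
    hsq.inv (by simpa using hne)
  have harg : ContDiffAt ℝ ∞ (fun z : ℝ × EuclideanSpace ℝ (Fin 3) => (Real.sqrt (-z.1))⁻¹ • z.2) (t, x) :=
    hinv.smul contDiffAt_snd
  have hη' : ContDiffAt ℝ ∞ (fun z : ℝ × EuclideanSpace ℝ (Fin 3) => η ((Real.sqrt (-z.1))⁻¹ • z.2)) (t, x) :=
    hη.contDiffAt.comp (t, x) harg
  exact (hsq.mul hη').contDiffWithinAt

/-- **Support of the weight**: with `η = χ̄(·/R)²`, `χ̄ = 0` off `B(0,2)`,
`ψ(t, x) = 0` whenever `2R√(−t) ≤ |x|`. [folklore] -/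
theorem selfSimilarWeight_eq_zero {χb : EuclideanSpace ℝ (Fin 3) → ℝ}
    (hχb0 : ∀ x, 2 ≤ ‖x‖ → χb x = 0) {R : ℝ} (hR : 0 < R)
    (hη : η = fun y => χb (R⁻¹ • y) ^ 2) {t : ℝ} (ht : t < 0) {x : EuclideanSpace ℝ (Fin 3)}
    (hx : 2 * R * Real.sqrt (-t) ≤ ‖x‖) :
    Real.sqrt (-t) * η ((Real.sqrt (-t))⁻¹ • x) = 0 := by
  have hc : 0 < Real.sqrt (-t) := Real.sqrt_pos.2 (by linarith)
  rw [hη]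
  simp only
  have h0 : χb (R⁻¹ • (Real.sqrt (-t))⁻¹ • x) = 0 := by
    refine hχb0 _ ?_
    rw [smul_smul, norm_smul, Real.norm_of_nonneg (by positivity),
      show R⁻¹ * (Real.sqrt (-t))⁻¹ = (R * Real.sqrt (-t))⁻¹ by rw [mul_inv],
      le_inv_mul_iff₀ (by positivity)]
    linarith
  rw [h0]
  simp

end PsiCalculus

section ScalingAlgebra

-- nested operator types
set_option maxSynthPendingDepth 3

/-- **Vorticity of a similarity profile**: `curl(c • v(c ·))(y) = c² • (curl v)(c y)`. [folklore] -/
theorem curl_const_smul_comp_smul (v : EuclideanSpace ℝ (Fin 3) → EuclideanSpace ℝ (Fin 3)) (c : ℝ)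
    (y : EuclideanSpace ℝ (Fin 3)) :
    curl (fun z => c • v (c • z)) y = c ^ 2 • curl v (c • y) := by
  rw [curl_eq_curlCLM, curl_eq_curlCLM, fderiv_smul_comp_smul, map_smul]

/-- `D(curl(c • v(c ·)))(y) = c³ • D(curl v)(c y)`. [folklore] -/
theorem fderiv_curl_smul_comp_smul (v : EuclideanSpace ℝ (Fin 3) → EuclideanSpace ℝ (Fin 3))
    (c : ℝ) (y : EuclideanSpace ℝ (Fin 3)) :
    fderiv ℝ (curl fun z => c • v (c • z)) y = c ^ 3 • fderiv ℝ (curl v) (c • y) := by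
  have e : (curl fun z => c • v (c • z)) = fun z => c ^ 2 • curl v (c • z) :=
    funext fun z => curl_const_smul_comp_smul v c z
  rw [e, fderiv_const_smul_comp_smul', show c ^ 2 * c = c ^ 3 by ring]

/-- `|c • L|²_F = c² |L|²_F`. [folklore] -/
theorem frobeniusNormSq_const_smul_fin3 {F : Type*} [NormedAddCommGroup F] [InnerProductSpace ℝ F]
    [FiniteDimensional ℝ F] (c : ℝ) (L : EuclideanSpace ℝ (Fin 3) →L[ℝ] F) :
    frobeniusNormSq (c • L) = c ^ 2 * frobeniusNormSq L := by
  unfold frobeniusNormSq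
  rw [Finset.mul_sum]
  refine Finset.sum_congr rfl fun i _ => ?_
  show ‖c • L (stdOrthonormalBasis ℝ (EuclideanSpace ℝ (Fin 3)) i)‖ ^ 2 =
    c ^ 2 * ‖L (stdOrthonormalBasis ℝ (EuclideanSpace ℝ (Fin 3)) i)‖ ^ 2
  rw [norm_smul, mul_pow, Real.norm_eq_abs, sq_abs]

/-- **Substitution `x = c y` in `ℝ³`**: `∫ f(c⁻¹ x) dx = c³ ∫ f(y) dy` for `c > 0`. [folklore] -/
theorem integral_comp_inv_smul_fin3 {F : Type*} [NormedAddCommGroup F] [NormedSpace ℝ F]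
    (f : EuclideanSpace ℝ (Fin 3) → F) {c : ℝ} (hc : 0 < c) :
    ∫ x, f (c⁻¹ • x) = c ^ 3 • ∫ y, f y := by
  rw [Measure.integral_comp_inv_smul volume f c, finrank_euclideanSpace_fin, abs_of_pos (pow_pos hc 3)]

end ScalingAlgebra


section VorticityEqCutoff

-- nested operator types
set_option maxSynthPendingDepth 3

variable {u : ℝ → EuclideanSpace ℝ (Fin 3) → EuclideanSpace ℝ (Fin 3)}
  {p : ℝ → EuclideanSpace ℝ (Fin 3) → ℝ} {ζ : EuclideanSpace ℝ (Fin 3) → ℝ}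
  {ut : ℝ → EuclideanSpace ℝ (Fin 3) → EuclideanSpace ℝ (Fin 3)}

/-- The gradient of a `C^{n+1}` function is `Cⁿ`. [folklore] -/
theorem contDiff_gradient_of_contDiff {P : EuclideanSpace ℝ (Fin 3) → ℝ} {n : ℕ∞}
    (hP : ContDiff ℝ (n + 1) P) : ContDiff ℝ n (gradient P) := by
  have e : gradient P = fun y => (InnerProductSpace.toDual ℝ (EuclideanSpace ℝ (Fin 3))).symm
      (fderiv ℝ P y) := rfl
  rw [e]
  exact (InnerProductSpace.toDual ℝ (EuclideanSpace ℝ (Fin 3))).symm.contDiff.comp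
    (hP.fderiv_right (m := n) le_rfl)

/-- **The vorticity equation of the cut-off field on the plateau of the cut-off**: for a
classical solution on `[-1,0) × B₁` (`ν = 1`, `f = 0`) and `ũ = ζu` with `ζ ∈ C^∞_c(B₁)`,
`ζ = 1` near every point of `B(0, ½)`, one has at every `t ∈ (-1,0)`, `x ∈ B(0,½)`:
`∂ₜ curl ũ = Δ(curl ũ) − (ũ·∇)(curl ũ) + (curl ũ·∇)ũ`
(exchange `∂ₜ curl = curl ∂ₜ` for the jointly smooth `ũ`, the momentum equation of `u`
transported along `ũ = u` near `x`, `curl Δ = Δ curl`, `curl((u·∇)u) = (u·∇)ω − (ω·∇)u + (div u)ω`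
with `div u = 0`, and `curl ∇p̃ = 0`). [cite: PineauVicol2026, (9.8), arXiv:2607.09619 p. 31] -/
theorem deriv_curl_cutoff_slice_eq
    (hreg : IsClassicalNSSolutionOnRegion
      (Ico (-1 : ℝ) 0 ×ˢ ball (0 : EuclideanSpace ℝ (Fin 3)) 1) 1 0 u p)
    (hζ : ContDiff ℝ ∞ ζ) (hζs : tsupport ζ ⊆ ball (0 : EuclideanSpace ℝ (Fin 3)) 1)
    (hζ1 : ∀ x ∈ ball (0 : EuclideanSpace ℝ (Fin 3)) (1 / 2), ζ =ᶠ[𝓝 x] fun _ => (1 : ℝ))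
    (hut : ut = fun t x => ζ x • u t x)
    {t : ℝ} (ht : t ∈ Ioo (-1 : ℝ) 0) {x : EuclideanSpace ℝ (Fin 3)}
    (hx : x ∈ ball (0 : EuclideanSpace ℝ (Fin 3)) (1 / 2)) :
    deriv (fun s => curl (ut s) x) t =
      (Δ (curl (ut t))) x - convect (ut t) (curl (ut t)) x + convect (curl (ut t)) (ut t) x := by
  -- the open time interval
  have hS : IsOpen (Ioo (-1 : ℝ) 0) := isOpen_Ioo
  have hSu : UniqueDiffOn ℝ (Ioo (-1 : ℝ) 0) := hS.uniqueDiffOn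
  have hcl : Ioo (-1 : ℝ) 0 ⊆ closure (interior (Ioo (-1 : ℝ) 0)) := by
    rw [hS.interior_eq]; exact subset_closure
  -- joint smoothness of `ũ` and of the cut-off pressure
  have hsm : IsSmoothSpaceTimeOn (Ioo (-1 : ℝ) 0) ut := by
    rw [hut]; exact isSmoothSpaceTimeOn_cutoff_smul hreg.smooth_velocity hζ hζs
  obtain ⟨pt, hpt⟩ : ∃ pt : EuclideanSpace ℝ (Fin 3) → ℝ, pt = fun y => ζ y * p t y := ⟨_, rfl⟩
  have hpsm : IsSmoothSpaceTimeOn (Ioo (-1 : ℝ) 0) fun s y => ζ y • p s y :=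
    isSmoothSpaceTimeOn_cutoff_smul hreg.smooth_pressure hζ hζs
  have hpts : ContDiff ℝ ∞ pt := by
    rw [hpt]; exact hpsm.contDiff_slice ht
  have huts : ContDiff ℝ ∞ (ut t) := hsm.contDiff_slice ht
  have hut3 : ContDiff ℝ 3 (ut t) := huts.of_le (by norm_cast)
  have hut2 : ContDiff ℝ 2 (ut t) := huts.of_le (by norm_cast)
  have hut1 : ContDiff ℝ 1 (ut t) := huts.of_le (by norm_cast)
  have hpt2 : ContDiff ℝ 2 pt := hpts.of_le (by norm_cast)
  -- step 1: `∂ₜ curl ũ = curl ∂ₜ ũ`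
  have s1 : deriv (fun s => curl (ut s) x) t = curl (timeDerivWithin (Ioo (-1 : ℝ) 0) ut t) x := by
    rw [hsm.curl_timeDerivWithin hSu hcl ht x, timeDerivWithin_eq_deriv hS ht]
    rfl
  rw [s1]
  -- step 2: `∂ₜ ũ = Δũ − (ũ·∇)ũ − ∇p̃` near `x`
  have hxball1 : ∀ y ∈ ball (0 : EuclideanSpace ℝ (Fin 3)) (1 / 2),
      y ∈ ball (0 : EuclideanSpace ℝ (Fin 3)) 1 := fun y hy =>
    ball_subset_ball (by norm_num) hy
  have hW : timeDerivWithin (Ioo (-1 : ℝ) 0) ut t =ᶠ[𝓝 x]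
      fun y => ((Δ (ut t)) y - convect (ut t) (ut t) y) - gradient pt y := by
    filter_upwards [isOpen_ball.mem_nhds hx] with y hy
    have hy1 := hxball1 y hy
    have hζy : ζ =ᶠ[𝓝 y] fun _ => (1 : ℝ) := hζ1 y hy
    have hζy1 : ζ y = 1 := hζy.self_of_nhds
    have huy : (fun z => ζ z • u t z) =ᶠ[𝓝 y] u t := cutoff_smul_slice_eventuallyEq hζy t
    have hpy : (fun z => ζ z • p t z) =ᶠ[𝓝 y] p t := cutoff_smul_slice_eventuallyEq hζy t
    have huy' : ut t =ᶠ[𝓝 y] u t := by rw [hut]; exact huy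
    have hpy' : pt =ᶠ[𝓝 y] p t := by rw [hpt]; simpa only [smul_eq_mul] using hpy
    -- the time derivative of `ũ` at `y` is that of `u`
    have hO : IsOpen (Ioo (-1 : ℝ) 0 ×ˢ ball (0 : EuclideanSpace ℝ (Fin 3)) 1) := isOpen_Ioo.prod isOpen_ball
    have hdu : DifferentiableAt ℝ (fun s => u s y) t := by
      have h := (hreg.smooth_velocity.mono (prod_mono Ioo_subset_Ico_self Subset.rfl)).contDiffAt
        (hO.mem_nhds (mk_mem_prod ht hy1))
      exact (hasDerivAt_timeLine (h.differentiableAt (by simp)).hasFDerivAt).differentiableAt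
    have hT : timeDerivWithin (Ioo (-1 : ℝ) 0) ut t y = deriv (fun s => u s y) t := by
      rw [timeDerivWithin_eq_deriv hS ht, hut]
      have hd : HasDerivAt (fun s => ζ y • u s y) (ζ y • deriv (fun s => u s y) t) t :=
        hdu.hasDerivAt.const_smul (ζ y)
      show deriv (fun s => ζ y • u s y) t = deriv (fun s => u s y) t
      rw [hd.deriv, hζy1, one_smul]
    -- the momentum equation of `u` at `(t, y)`
    have hmom := hreg.momentum t y (mk_mem_prod (Ioo_subset_Ico_self ht) hy1)
    rw [timeDerivOn_prod (Ico (-1 : ℝ) 0) u t hy1, timeDerivWithin_apply,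
      derivWithin_of_mem_nhds (Ico_mem_nhds ht.1 ht.2)] at hmom
    have hderiv : deriv (fun s => u s y) t =
        ((Δ (u t)) y - convect (u t) (u t) y) - gradient (p t) y := by
      have h0 : (0 : ℝ → EuclideanSpace ℝ (Fin 3) → EuclideanSpace ℝ (Fin 3)) t y = 0 := rfl
      rw [h0, add_zero, one_smul] at hmom
      rw [eq_sub_of_add_eq hmom]; abel
    rw [hT, hderiv]
    -- transport along `ũ = u`, `p̃ = p` near `y`
    have eΔ : (Δ (u t)) y = (Δ (ut t)) y := (InnerProductSpace.laplacian_congr_nhds huy').eq_of_nhds.symm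
    have eD : fderiv ℝ (u t) y = fderiv ℝ (ut t) y := huy'.fderiv_eq.symm
    have e0 : u t y = ut t y := huy'.self_of_nhds.symm
    have eG : gradient (p t) y = gradient pt y := by
      show (InnerProductSpace.toDual ℝ (EuclideanSpace ℝ (Fin 3))).symm (fderiv ℝ (p t) y) =
        (InnerProductSpace.toDual ℝ (EuclideanSpace ℝ (Fin 3))).symm (fderiv ℝ pt y)
      rw [hpy'.fderiv_eq]
    simp only [convect, eΔ, eD, e0, eG]
  -- step 3: curl of the right-hand side
  have s3 : curl (timeDerivWithin (Ioo (-1 : ℝ) 0) ut t) x =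
      curl (fun y => ((Δ (ut t)) y - convect (ut t) (ut t) y) - gradient pt y) x := by
    rw [curl_eq_curlCLM, curl_eq_curlCLM, hW.fderiv_eq]
  rw [s3]
  -- differentiability of the three terms
  have hΔ : ContDiff ℝ 1 (Δ (ut t)) := contDiff_laplacian (n := 1) (by exact_mod_cast hut3)
  have hC : ContDiff ℝ 1 fun y => convect (ut t) (ut t) y :=
    (hut2.fderiv_right (m := 1) le_rfl).clm_apply hut1
  have hG : ContDiff ℝ 1 (gradient pt) := contDiff_gradient_of_contDiff (n := 1) (by exact_mod_cast hpt2)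
  have dΔ : DifferentiableAt ℝ (Δ (ut t)) x := (hΔ.differentiable one_ne_zero) x
  have dC : DifferentiableAt ℝ (fun y => convect (ut t) (ut t) y) x := (hC.differentiable one_ne_zero) x
  have dG : DifferentiableAt ℝ (gradient pt) x := (hG.differentiable one_ne_zero) x
  have dAC : DifferentiableAt ℝ (fun y => (Δ (ut t)) y - convect (ut t) (ut t) y) x := dΔ.sub dC
  rw [curl_sub dAC dG, curl_sub dΔ dC]
  -- the three curls
  have c1 : curl (Δ (ut t)) x = (Δ (curl (ut t))) x := curl_laplacian hut3 x
  have hdiv0 : VectorCalculus.divergence (ut t) x = 0 := by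
    have hζx : ζ =ᶠ[𝓝 x] fun _ => (1 : ℝ) := hζ1 x hx
    have hux : ut t =ᶠ[𝓝 x] u t := by rw [hut]; exact cutoff_smul_slice_eventuallyEq hζx t
    rw [divergence_eq_traceCLM, hux.fderiv_eq, ← divergence_eq_traceCLM]
    exact hreg.divFree t x (mk_mem_prod (Ioo_subset_Ico_self ht) (hxball1 x hx))
  have c2 : curl (fun y => convect (ut t) (ut t) y) x =
      convect (ut t) (curl (ut t)) x - convect (curl (ut t)) (ut t) x := by
    have h := curl_convect_self hut2 x
    rw [hdiv0, zero_smul, add_zero] at h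
    exact h
  have c3 : curl (gradient pt) x = 0 := curl_gradient_eq_zero_holds pt hpt2 x
  rw [c1, c2, c3, sub_zero]
  abel

end VorticityEqCutoff

section WeightedIBP

-- nested operator types
set_option maxSynthPendingDepth 3

/-- **The transport term against a Lipschitz weight, with the divergence vanishing only on the
support of the weight**: for `ζ, U ∈ C¹` with `div U = 0` on `tsupport η`,
`∫ ⟨ζ, (U·∇)ζ⟩ η = −½ ∫ |ζ|² (U·∇η)` (the tree's `integral_inner_convect_mul_weight` assumes
`div U = 0` everywhere; the same proof). [cite: Tao2011, §10, proof of Thm. 10.1 (term Y₄, (10.14))] -/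
theorem integral_inner_convect_mul_weight_of_tsupport
    {ζ U : EuclideanSpace ℝ (Fin 3) → EuclideanSpace ℝ (Fin 3)} (hζ : ContDiff ℝ 1 ζ)
    (hU : ContDiff ℝ 1 U) {η : EuclideanSpace ℝ (Fin 3) → ℝ}
    (hdiv : ∀ x ∈ tsupport η, VectorCalculus.divergence U x = 0) {C : ℝ≥0}
    (hη : LipschitzWith C η) (hηc : HasCompactSupport η) :
    ∫ x, ⟪ζ x, convect U ζ x⟫ * η x = -(1 / 2 * ∫ x, ‖ζ x‖ ^ 2 * lineDeriv ℝ η x (U x)) := by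
  -- the `C¹` scalar `N = |ζ|²` and the coordinate functions `Uⱼ`
  have hN : ContDiff ℝ 1 fun y => ‖ζ y‖ ^ 2 := hζ.norm_sq ℝ
  have hNc : Continuous fun y => ‖ζ y‖ ^ 2 := hN.continuous
  have hNd : ∀ j : Fin 3, Continuous fun x => fderiv ℝ (fun y => ‖ζ y‖ ^ 2) x
      (EuclideanSpace.single j (1 : ℝ)) := fun j =>
    (hN.continuous_fderiv one_ne_zero).clm_apply continuous_const
  have hUj : ∀ j : Fin 3, ContDiff ℝ 1 fun y => U y j := fun j =>
    (EuclideanSpace.proj j : EuclideanSpace ℝ (Fin 3) →L[ℝ] ℝ).contDiff.comp hU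
  have hUjc : ∀ j : Fin 3, Continuous fun y => U y j := fun j => (hUj j).continuous
  -- the weights `wⱼ = Uⱼ η`: Lipschitz with compact support
  have hw : ∀ j : Fin 3, ∃ D : ℝ≥0, LipschitzWith D fun x => U x j * η x := fun j =>
    exists_lipschitzWith_mul_of_contDiff (hUj j) hη hηc
  choose D hD using hw
  have hwc : ∀ j : Fin 3, HasCompactSupport fun x => U x j * η x := fun j => hηc.mul_left
  -- `(div U) η = 0` everywhere
  have hdivη : ∀ x, VectorCalculus.divergence U x * η x = 0 := by
    intro x
    by_cases hx : x ∈ tsupport η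
    · rw [hdiv x hx, zero_mul]
    · rw [image_eq_zero_of_notMem_tsupport hx, mul_zero]
  -- step 1: `⟨ζ, (U·∇)ζ⟩ η = ½ Σⱼ ∂ⱼN · (Uⱼ η)` pointwise
  have hpt : ∀ x, ⟪ζ x, convect U ζ x⟫ * η x =
      1 / 2 * ∑ j, fderiv ℝ (fun y => ‖ζ y‖ ^ 2) x (EuclideanSpace.single j (1 : ℝ)) * (U x j * η x) := by
    intro x
    rw [convect, inner_fderiv_apply_eq_half_fderiv_norm_sq ((hζ.differentiable one_ne_zero) x),
      clm_real_apply_coord, mul_assoc, Finset.sum_mul]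
    congr 1
    exact Finset.sum_congr rfl fun j _ => by ring
  -- step 2: integrate, integrate by parts with the weights `wⱼ`
  have hI1 : ∀ j : Fin 3, Integrable fun x =>
      fderiv ℝ (fun y => ‖ζ y‖ ^ 2) x (EuclideanSpace.single j (1 : ℝ)) * (U x j * η x) := fun j =>
    integrable_mul_of_continuous_of_hasCompactSupport (hNd j) ((hUjc j).mul hη.continuous) (hwc j)
  have hI2 : ∀ j : Fin 3, Integrable fun x =>
      ‖ζ x‖ ^ 2 * lineDeriv ℝ (fun x => U x j * η x) x (EuclideanSpace.single j (1 : ℝ)) := fun j =>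
    integrable_mul_lineDeriv hNc (hD j) (hwc j) _
  simp_rw [hpt]
  rw [integral_const_mul, integral_finsetSum _ fun j _ => hI1 j]
  have hibp : ∀ j : Fin 3, ∫ x, fderiv ℝ (fun y => ‖ζ y‖ ^ 2) x (EuclideanSpace.single j (1 : ℝ)) *
      (U x j * η x) =
      -∫ x, ‖ζ x‖ ^ 2 * lineDeriv ℝ (fun x => U x j * η x) x (EuclideanSpace.single j (1 : ℝ)) :=
    fun j => integral_fderiv_apply_mul_eq_neg_integral_mul_lineDeriv volume hN (hD j) (hwc j) _
  simp_rw [hibp]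
  rw [Finset.sum_neg_distrib, ← integral_finsetSum _ fun j _ => hI2 j, mul_neg]
  congr 2
  -- step 3: `Σⱼ ∂ⱼ(Uⱼ η) = (div U) η + U·∇η = U·∇η` almost everywhere
  refine integral_congr_ae ?_
  filter_upwards [hη.ae_differentiableAt (μ := volume)] with x hx
  rw [← Finset.mul_sum]
  congr 1
  have hUd : DifferentiableAt ℝ U x := (hU.differentiable one_ne_zero) x
  have hUjd : ∀ j : Fin 3, DifferentiableAt ℝ (fun y => U y j) x := fun j =>
    ((hUj j).differentiable one_ne_zero) x
  have hterm : ∀ j : Fin 3, lineDeriv ℝ (fun x => U x j * η x) x (EuclideanSpace.single j (1 : ℝ)) =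
      fderiv ℝ (fun y => U y j) x (EuclideanSpace.single j (1 : ℝ)) * η x +
        U x j * lineDeriv ℝ η x (EuclideanSpace.single j (1 : ℝ)) := by
    intro j
    have hd : DifferentiableAt ℝ (fun y => U y j * η y) x := (hUjd j).mul hx
    rw [hd.lineDeriv_eq_fderiv, fderiv_fun_mul (hUjd j) hx, hx.lineDeriv_eq_fderiv]
    simp only [_root_.add_apply, FunLike.coe_smul, Pi.smul_apply, smul_eq_mul]
    ring
  simp_rw [hterm]
  rw [Finset.sum_add_distrib, ← Finset.sum_mul, ← divergence_eq_sum_fderiv_coord hUd, hdivη x,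
    zero_add, lineDeriv_eq_sum_coord hx (U x)]

/-- **The viscous term against a smooth compactly supported weight, integrated by parts twice**:
for `ζ ∈ C²` and `w ∈ C²_c`,
`∫ ⟨ζ, Δζ⟩ w = ½ ∫ |ζ|² Δw − ∫ |Dζ|²_F w`. [cite: Tao2011, §10, proof of Thm. 10.1 (terms Y₁, Y₃)] -/
theorem integral_inner_laplacian_mul_smooth_weight
    {ζ : EuclideanSpace ℝ (Fin 3) → EuclideanSpace ℝ (Fin 3)} (hζ : ContDiff ℝ 2 ζ)
    {w : EuclideanSpace ℝ (Fin 3) → ℝ} (hw : ContDiff ℝ 2 w) (hwc : HasCompactSupport w) :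
    ∫ x, ⟪ζ x, (Δ ζ) x⟫ * w x =
      1 / 2 * (∫ x, ‖ζ x‖ ^ 2 * (Δ w) x) - ∫ x, frobeniusNormSq (fderiv ℝ ζ x) * w x := by
  obtain ⟨C, hwL⟩ := hw.lipschitzWith_of_hasCompactSupport hwc two_ne_zero
  have h1 := integral_inner_laplacian_mul_weight hζ hwL hwc
  rw [h1]
  congr 1
  -- the once-integrated term
  have hζ1 : ContDiff ℝ 1 ζ := hζ.of_le (by norm_num)
  have hN : ContDiff ℝ 1 fun y => ‖ζ y‖ ^ 2 := hζ1.norm_sq ℝ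
  have hw1 : ContDiff ℝ 1 w := hw.of_le (by norm_num)
  have hwd : Differentiable ℝ w := hw1.differentiable one_ne_zero
  -- the weights `wⱼ = ∂ⱼ w`
  have hwj : ∀ j : Fin 3, ContDiff ℝ 1 fun x => fderiv ℝ w x (EuclideanSpace.single j (1 : ℝ)) :=
    fun j => (hw.fderiv_right (m := 1) le_rfl).clm_apply contDiff_const
  have hwjc : ∀ j : Fin 3, HasCompactSupport fun x => fderiv ℝ w x (EuclideanSpace.single j (1 : ℝ)) :=
    fun j => hwc.fderiv_apply ℝ (EuclideanSpace.single j (1 : ℝ))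
  have hwjL : ∀ j : Fin 3, ∃ D : ℝ≥0, LipschitzWith D fun x => fderiv ℝ w x (EuclideanSpace.single j (1 : ℝ)) :=
    fun j => (hwj j).lipschitzWith_of_hasCompactSupport (hwjc j) one_ne_zero
  choose D hD using hwjL
  -- each `j`
  have hj : ∀ j : Fin 3, ∫ x, ⟪ζ x, fderiv ℝ ζ x (EuclideanSpace.single j (1 : ℝ))⟫ *
      lineDeriv ℝ w x (EuclideanSpace.single j (1 : ℝ)) =
      -(1 / 2 * ∫ x, ‖ζ x‖ ^ 2 * fderiv ℝ (fderiv ℝ w) x (EuclideanSpace.single j (1 : ℝ))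
        (EuclideanSpace.single j (1 : ℝ))) := by
    intro j
    have hpt : ∀ x, ⟪ζ x, fderiv ℝ ζ x (EuclideanSpace.single j (1 : ℝ))⟫ *
        lineDeriv ℝ w x (EuclideanSpace.single j (1 : ℝ)) =
        1 / 2 * (fderiv ℝ (fun y => ‖ζ y‖ ^ 2) x (EuclideanSpace.single j (1 : ℝ)) *
          fderiv ℝ w x (EuclideanSpace.single j (1 : ℝ))) := by
      intro x
      rw [inner_fderiv_apply_eq_half_fderiv_norm_sq ((hζ1.differentiable one_ne_zero) x),
        (hwd x).lineDeriv_eq_fderiv, mul_assoc]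
    simp_rw [hpt]
    rw [integral_const_mul,
      integral_fderiv_apply_mul_eq_neg_integral_mul_lineDeriv volume hN (hD j) (hwjc j) _]
    have hI : ∫ x, ‖ζ x‖ ^ 2 * lineDeriv ℝ (fun x => fderiv ℝ w x (EuclideanSpace.single j (1 : ℝ))) x
        (EuclideanSpace.single j (1 : ℝ)) =
        ∫ x, ‖ζ x‖ ^ 2 * fderiv ℝ (fderiv ℝ w) x (EuclideanSpace.single j (1 : ℝ))
          (EuclideanSpace.single j (1 : ℝ)) := by
      refine integral_congr_ae (Eventually.of_forall fun x => ?_)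
      have hdj : DifferentiableAt ℝ (fun x => fderiv ℝ w x (EuclideanSpace.single j (1 : ℝ))) x :=
        ((hwj j).differentiable one_ne_zero) x
      simp only
      rw [hdj.lineDeriv_eq_fderiv, fderiv_fderiv_apply_eq hw]
    rw [hI]
    ring
  simp_rw [hj]
  rw [Finset.sum_neg_distrib, neg_neg, ← Finset.mul_sum]
  congr 1
  -- `Σⱼ ∫ N ∂ⱼⱼ w = ∫ N Δw`
  have hint : ∀ j : Fin 3, Integrable fun x => ‖ζ x‖ ^ 2 *
      fderiv ℝ (fderiv ℝ w) x (EuclideanSpace.single j (1 : ℝ)) (EuclideanSpace.single j (1 : ℝ)) := by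
    intro j
    have hc : Continuous fun x => fderiv ℝ (fderiv ℝ w) x (EuclideanSpace.single j (1 : ℝ))
        (EuclideanSpace.single j (1 : ℝ)) :=
      (((hw.fderiv_right (m := 1) le_rfl).continuous_fderiv one_ne_zero).clm_apply
        continuous_const).clm_apply continuous_const
    have hs : HasCompactSupport fun x => fderiv ℝ (fderiv ℝ w) x (EuclideanSpace.single j (1 : ℝ))
        (EuclideanSpace.single j (1 : ℝ)) :=
      ((hwc.fderiv ℝ).fderiv_apply ℝ (EuclideanSpace.single j (1 : ℝ))).comp_left
        (g := fun L : EuclideanSpace ℝ (Fin 3) →L[ℝ] ℝ => L (EuclideanSpace.single j (1 : ℝ))) (by simp)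
    exact integrable_mul_of_continuous_of_hasCompactSupport hN.continuous hc hs
  rw [← integral_finsetSum _ fun j _ => hint j]
  refine integral_congr_ae (Eventually.of_forall fun x => ?_)
  simp only
  rw [← Finset.mul_sum, laplacian_apply_eq_sum_fderiv_fderiv (EuclideanSpace.basisFun (Fin 3) ℝ) w x]
  congr 1
  refine Finset.sum_congr rfl fun j _ => ?_
  rw [EuclideanSpace.basisFun_apply]

end WeightedIBP


section EnstrophyDerivative

-- nested operator types
set_option maxSynthPendingDepth 3

variable {u : ℝ → EuclideanSpace ℝ (Fin 3) → EuclideanSpace ℝ (Fin 3)}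
  {p : ℝ → EuclideanSpace ℝ (Fin 3) → ℝ} {ζ : EuclideanSpace ℝ (Fin 3) → ℝ}
  {ut : ℝ → EuclideanSpace ℝ (Fin 3) → EuclideanSpace ℝ (Fin 3)}
  {χb η : EuclideanSpace ℝ (Fin 3) → ℝ} {ψ : ℝ → EuclideanSpace ℝ (Fin 3) → ℝ} {R T₁ : ℝ}

/-- `div ũ = 0` on `B(0, ½)` for the cut-off field of a classical solution. [folklore] -/
theorem divergence_cutoff_eq_zero
    (hreg : IsClassicalNSSolutionOnRegion
      (Ico (-1 : ℝ) 0 ×ˢ ball (0 : EuclideanSpace ℝ (Fin 3)) 1) 1 0 u p)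
    (hζ1 : ∀ x ∈ ball (0 : EuclideanSpace ℝ (Fin 3)) (1 / 2), ζ =ᶠ[𝓝 x] fun _ => (1 : ℝ))
    (hut : ut = fun t x => ζ x • u t x) {t : ℝ} (ht : t ∈ Ioo (-1 : ℝ) 0)
    {x : EuclideanSpace ℝ (Fin 3)} (hx : x ∈ ball (0 : EuclideanSpace ℝ (Fin 3)) (1 / 2)) :
    VectorCalculus.divergence (ut t) x = 0 := by
  have hux : ut t =ᶠ[𝓝 x] u t := by rw [hut]; exact cutoff_smul_slice_eventuallyEq (hζ1 x hx) t
  rw [divergence_eq_traceCLM, hux.fderiv_eq, ← divergence_eq_traceCLM]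
  exact hreg.divFree t x (mk_mem_prod (Ioo_subset_Ico_self ht) (ball_subset_ball (by norm_num) hx))

/-- The scale bound on the good time interval: `2R√(−t) < ½` for `t ∈ (−T₁, 0)` when
`2R√T₁ ≤ ½`. [folklore] -/
theorem two_mul_R_sqrt_lt (hR : 0 < R) (hRT : 2 * R * Real.sqrt T₁ ≤ 1 / 2)
    {t : ℝ} (ht : t ∈ Ioo (-T₁) 0) : 2 * R * Real.sqrt (-t) < 1 / 2 := by
  have h1 : Real.sqrt (-t) < Real.sqrt T₁ := Real.sqrt_lt_sqrt (by linarith [ht.2]) (by linarith [ht.1])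
  have h2 : 2 * R * Real.sqrt (-t) < 2 * R * Real.sqrt T₁ := by
    exact mul_lt_mul_of_pos_left h1 (by positivity)
  linarith

/-- The `η = χ̄(·/R)²` weight and its derivative vanish near every point with `|y| > 2R`. [folklore] -/
theorem eta_eventuallyEq_zero (hχb0 : ∀ x, 2 ≤ ‖x‖ → χb x = 0) (hR : 0 < R)
    (hη : η = fun y => χb (R⁻¹ • y) ^ 2) {y : EuclideanSpace ℝ (Fin 3)} (hy : 2 * R < ‖y‖) :
    η =ᶠ[𝓝 y] fun _ => (0 : ℝ) := by
  have ho : IsOpen {z : EuclideanSpace ℝ (Fin 3) | 2 * R < ‖z‖} := isOpen_lt continuous_const continuous_norm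
  filter_upwards [ho.mem_nhds hy] with z hz
  rw [hη]
  simp only
  have h0 : χb (R⁻¹ • z) = 0 := by
    refine hχb0 _ ?_
    rw [norm_smul, Real.norm_of_nonneg (inv_nonneg.2 hR.le), le_inv_mul_iff₀ hR]
    exact (le_of_lt hz).trans_eq' (by ring)
  rw [h0]; simp

set_option maxHeartbeats 1600000 in
/-- **The localised enstrophy identity along the self-similar weight** (Pineau–Vicol (9.9) in
physical variables): for a classical solution `(u, p)` on `[-1,0) × B₁` (`ν = 1`, `f = 0`),
its cut-off `ũ = ζu` (`ζ = 1` near `B̄(0,½)`, `supp ζ ⊆ B₁`), the weight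
`ψ(t,x) = √(−t) η(x/√(−t))`, `η = χ̄(·/R)²`, and times `t ∈ (−T₁, 0)` with `2R√T₁ ≤ ½`
(so that `supp ψ(t) ⊆ B(0,½)`), the weighted enstrophy `W(t) = ∫ ψ(t)|curl ũ(t)|²` is
differentiable with
`W'(t) = ∫ (∂ₜψ + Δψ + Dψ[ũ]) |ω̃|² − 2∫ ψ |Dω̃|²_F + 2∫ ψ ⟨ω̃, Dũ ω̃⟩`
(differentiation under the integral, the vorticity equation of `ũ` on `B(0,½)`
(`deriv_curl_cutoff_slice_eq`), and integration by parts of the viscous and transport terms).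
[cite: PineauVicol2026, (9.8)–(9.9), arXiv:2607.09619 p. 31] -/
theorem hasDerivAt_weightedEnstrophy
    (hreg : IsClassicalNSSolutionOnRegion
      (Ico (-1 : ℝ) 0 ×ˢ ball (0 : EuclideanSpace ℝ (Fin 3)) 1) 1 0 u p)
    (hζ : ContDiff ℝ ∞ ζ) (hζs : tsupport ζ ⊆ ball (0 : EuclideanSpace ℝ (Fin 3)) 1)
    (hζ1 : ∀ x ∈ ball (0 : EuclideanSpace ℝ (Fin 3)) (1 / 2), ζ =ᶠ[𝓝 x] fun _ => (1 : ℝ))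
    (hut : ut = fun t x => ζ x • u t x)
    (hχb : ContDiff ℝ ∞ χb) (hχb0 : ∀ x, 2 ≤ ‖x‖ → χb x = 0) (hR : 0 < R)
    (hη : η = fun y => χb (R⁻¹ • y) ^ 2)
    (hψ : ψ = fun t x => Real.sqrt (-t) * η ((Real.sqrt (-t))⁻¹ • x))
    (hT₁ : T₁ ≤ 1) (hRT : 2 * R * Real.sqrt T₁ ≤ 1 / 2)
    {t : ℝ} (ht : t ∈ Ioo (-T₁) 0) :
    HasDerivAt (fun s => ∫ x, ψ s x * ‖curl (ut s) x‖ ^ 2)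
      ((∫ x, (-(1 / (2 * Real.sqrt (-t))) *
              (η ((Real.sqrt (-t))⁻¹ • x) -
                fderiv ℝ η ((Real.sqrt (-t))⁻¹ • x) ((Real.sqrt (-t))⁻¹ • x)) +
            (Δ (ψ t)) x + fderiv ℝ (ψ t) x (ut t x)) * ‖curl (ut t) x‖ ^ 2) -
        2 * (∫ x, ψ t x * frobeniusNormSq (fderiv ℝ (curl (ut t)) x)) +
        2 * (∫ x, ψ t x * ⟪curl (ut t) x, fderiv ℝ (ut t) x (curl (ut t) x)⟫)) t := by
  -- the two open time intervals
  have hS : IsOpen (Ioo (-1 : ℝ) 0) := isOpen_Ioo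
  have hSu : UniqueDiffOn ℝ (Ioo (-1 : ℝ) 0) := hS.uniqueDiffOn
  have hS' : IsOpen (Ioo (-T₁) 0) := isOpen_Ioo
  have hsub : Ioo (-T₁) 0 ⊆ Ioo (-1 : ℝ) 0 := Ioo_subset_Ioo (by linarith) le_rfl
  have ht1 : t ∈ Ioo (-1 : ℝ) 0 := hsub ht
  have ht0 : t < 0 := ht.2
  obtain ⟨c, hc_def⟩ : ∃ c : ℝ, Real.sqrt (-t) = c := ⟨_, rfl⟩
  have hc : 0 < c := by rw [← hc_def]; exact Real.sqrt_pos.2 (by linarith)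
  have h2Rc : 2 * R * c < 1 / 2 := by rw [← hc_def]; exact two_mul_R_sqrt_lt hR hRT ht
  rw [hc_def]
  -- smoothness of the fields
  have hsm : IsSmoothSpaceTimeOn (Ioo (-1 : ℝ) 0) ut := by
    rw [hut]; exact isSmoothSpaceTimeOn_cutoff_smul hreg.smooth_velocity hζ hζs
  have hω : IsSmoothSpaceTimeOn (Ioo (-1 : ℝ) 0) fun s x => curl (ut s) x :=
    (hsm.fderiv_slice hSu).clm_comp curlCLM
  have hηs : ContDiff ℝ ∞ η := by rw [hη]; exact (hχb.comp (contDiff_const_smul _)).pow 2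
  have hψsm : IsSmoothSpaceTimeOn (Ioo (-T₁) 0) ψ := by
    rw [hψ]; exact isSmoothSpaceTimeOn_selfSimilarWeight hηs (fun s hs => hs.2)
  -- the integrand and its support
  have hΦ : IsSmoothSpaceTimeOn (Ioo (-T₁) 0) fun s x => ψ s x * ‖curl (ut s) x‖ ^ 2 := by
    have h1 : IsSmoothSpaceTimeOn (Ioo (-T₁) 0) fun s x => (inner ℝ (curl (ut s) x) (curl (ut s) x) : ℝ) :=
      (hω.mono hsub).inner (hω.mono hsub)
    have e : (fun s x => ψ s x * ‖curl (ut s) x‖ ^ 2) =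
        fun s x => ψ s x * (inner ℝ (curl (ut s) x) (curl (ut s) x) : ℝ) := by
      funext s x; rw [real_inner_self_eq_norm_sq]
    rw [e]; exact hψsm.mul h1
  have hψ0 : ∀ s ∈ Ioo (-T₁) 0, ∀ x : EuclideanSpace ℝ (Fin 3), 1 / 2 ≤ ‖x‖ → ψ s x = 0 := by
    intro s hs x hx
    rw [hψ]
    exact selfSimilarWeight_eq_zero hχb0 hR hη hs.2 ((two_mul_R_sqrt_lt hR hRT hs).le.trans hx)
  have hsupp : ∀ s ∈ Ioo (-T₁) 0, ∀ x ∉ closedBall (0 : EuclideanSpace ℝ (Fin 3)) (1 / 2),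
      ψ s x * ‖curl (ut s) x‖ ^ 2 = 0 := by
    intro s hs x hx
    rw [mem_closedBall_zero_iff, not_le] at hx
    rw [hψ0 s hs x hx.le, zero_mul]
  -- differentiation under the integral sign
  have hD := hasDerivAt_integral_of_support_subset (μ := volume) hS' hΦ
    (isCompact_closedBall (0 : EuclideanSpace ℝ (Fin 3)) (1 / 2)) hsupp ht
  refine hD.congr_deriv ?_
  -- the slice objects at time `t`
  obtain ⟨omg, hωdef⟩ : ∃ omg : EuclideanSpace ℝ (Fin 3) → EuclideanSpace ℝ (Fin 3), curl (ut t) = omg := ⟨_, rfl⟩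
  have huts : ContDiff ℝ ∞ (ut t) := hsm.contDiff_slice ht1
  have hωs : ContDiff ℝ ∞ omg := by rw [← hωdef]; exact hω.contDiff_slice ht1
  have hω2 : ContDiff ℝ 2 omg := hωs.of_le (by norm_cast)
  have hω1 : ContDiff ℝ 1 omg := hωs.of_le (by norm_cast)
  have hut1 : ContDiff ℝ 1 (ut t) := huts.of_le (by norm_cast)
  have hψt : ψ t = fun x => c * η (c⁻¹ • x) := by
    rw [hψ]; funext x; simp only [hc_def]
  have hψts : ContDiff ℝ ∞ (ψ t) := by rw [hψt]; exact contDiff_const.mul (hηs.comp (contDiff_const_smul _))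
  have hψt2 : ContDiff ℝ 2 (ψ t) := hψts.of_le (by norm_cast)
  have hψtc : HasCompactSupport (ψ t) := by
    refine HasCompactSupport.intro (isCompact_closedBall (0 : EuclideanSpace ℝ (Fin 3)) (1 / 2))
      fun x hx => ?_
    rw [mem_closedBall_zero_iff, not_le] at hx
    exact hψ0 t ht x hx.le
  have htsupp : tsupport (ψ t) ⊆ ball (0 : EuclideanSpace ℝ (Fin 3)) (1 / 2) := by
    -- `ψ(t) = 0` on the open set `{|x| > 2Rc}`, whose complement is `⊆ B(0, ½)`
    intro x hx
    by_contra hxb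
    rw [mem_ball_zero_iff, not_lt] at hxb
    have hopen : IsOpen {z : EuclideanSpace ℝ (Fin 3) | 2 * R * c < ‖z‖} :=
      isOpen_lt continuous_const continuous_norm
    have hzero : ∀ z ∈ {z : EuclideanSpace ℝ (Fin 3) | 2 * R * c < ‖z‖}, ψ t z = 0 := by
      intro z hz
      rw [hψ]
      exact selfSimilarWeight_eq_zero hχb0 hR hη ht0 (by rw [hc_def]; exact le_of_lt hz)
    have hxin : x ∈ {z : EuclideanSpace ℝ (Fin 3) | 2 * R * c < ‖z‖} := by
      show 2 * R * c < ‖x‖; linarith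
    have hnot : x ∉ tsupport (ψ t) := by
      rw [notMem_tsupport_iff_eventuallyEq]
      exact Filter.eventually_of_mem (hopen.mem_nhds hxin) hzero
    exact hnot hx
  -- pointwise derivative of the integrand
  have hpt : ∀ x, deriv (fun s => ψ s x * ‖curl (ut s) x‖ ^ 2) t =
      (-(1 / (2 * c)) * (η (c⁻¹ • x) - fderiv ℝ η (c⁻¹ • x) (c⁻¹ • x))) * ‖omg x‖ ^ 2 +
        ψ t x * (2 * ⟪omg x, deriv (fun s => curl (ut s) x) t⟫) := by
    intro x
    have hψd : HasDerivAt (fun s => ψ s x)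
        (-(1 / (2 * c)) * (η (c⁻¹ • x) - fderiv ℝ η (c⁻¹ • x) (c⁻¹ • x))) t := by
      rw [hψ, ← hc_def]
      exact hasDerivAt_selfSimilarWeight (hηs.differentiable (by simp)) ht0 x
    have hωd : HasDerivAt (fun s => curl (ut s) x) (deriv (fun s => curl (ut s) x) t) t :=
      (hω.mono hsub).hasDerivAt_timeLine hS' ht x
    have hN : HasDerivAt (fun s => ‖curl (ut s) x‖ ^ 2) (2 * ⟪omg x, deriv (fun s => curl (ut s) x) t⟫) t := by
      have h := hωd.inner ℝ hωd
      have e : (fun s => ‖curl (ut s) x‖ ^ 2) = fun s => ⟪curl (ut s) x, curl (ut s) x⟫ := by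
        funext s; rw [real_inner_self_eq_norm_sq]
      rw [e]
      refine h.congr_deriv ?_
      rw [← hωdef, real_inner_comm]
      ring
    have hprod : HasDerivAt (fun s => ψ s x * ‖curl (ut s) x‖ ^ 2)
        (-(1 / (2 * c)) * (η (c⁻¹ • x) - fderiv ℝ η (c⁻¹ • x) (c⁻¹ • x)) * ‖curl (ut t) x‖ ^ 2 +
          ψ t x * (2 * ⟪omg x, deriv (fun s => curl (ut s) x) t⟫)) t := hψd.mul hN
    rw [hprod.deriv, hωdef]
  -- the vorticity equation where `ψ(t) ≠ 0`
  have hpt2 : ∀ x, ψ t x * (2 * ⟪omg x, deriv (fun s => curl (ut s) x) t⟫) =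
      2 * (⟪omg x, (Δ omg) x⟫ * ψ t x) - 2 * (⟪omg x, convect (ut t) omg x⟫ * ψ t x) +
        2 * (ψ t x * ⟪omg x, fderiv ℝ (ut t) x (omg x)⟫) := by
    intro x
    by_cases hx : x ∈ ball (0 : EuclideanSpace ℝ (Fin 3)) (1 / 2)
    · rw [deriv_curl_cutoff_slice_eq hreg hζ hζs hζ1 hut ht1 hx, hωdef]
      simp only [convect, inner_add_right, inner_sub_right]
      ring
    · rw [mem_ball_zero_iff, not_lt] at hx
      rw [hψ0 t ht x hx]
      ring
  -- integrability of the pieces (continuous, the weight compactly supported)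
  have hηc : Continuous η := hηs.continuous
  have hcont_pψ : Continuous fun x => -(1 / (2 * c)) * (η (c⁻¹ • x) - fderiv ℝ η (c⁻¹ • x) (c⁻¹ • x)) := by
    refine continuous_const.mul ((hηc.comp (continuous_const_smul _)).sub ?_)
    exact ((hηs.continuous_fderiv (by simp)).comp (continuous_const_smul _)).clm_apply
      (continuous_const_smul _)
  have hsupp_pψ : HasCompactSupport fun x =>
      -(1 / (2 * c)) * (η (c⁻¹ • x) - fderiv ℝ η (c⁻¹ • x) (c⁻¹ • x)) := by
    refine HasCompactSupport.intro (isCompact_closedBall (0 : EuclideanSpace ℝ (Fin 3)) (2 * R * c))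
      fun x hx => ?_
    rw [mem_closedBall_zero_iff, not_le] at hx
    have hy : 2 * R < ‖c⁻¹ • x‖ := by
      rw [norm_smul, Real.norm_of_nonneg (inv_nonneg.2 hc.le), lt_inv_mul_iff₀ hc]
      linarith
    have h0 := eta_eventuallyEq_zero hχb0 hR hη hy
    rw [h0.self_of_nhds, h0.fderiv_eq, fderiv_const_apply]
    simp
  have hωc : Continuous omg := hω1.continuous
  have hNc : Continuous fun x => ‖omg x‖ ^ 2 := hωc.norm.pow 2
  have hψtcont : Continuous (ψ t) := hψts.continuous
  have i1 : Integrable fun x => (-(1 / (2 * c)) * (η (c⁻¹ • x) - fderiv ℝ η (c⁻¹ • x) (c⁻¹ • x))) *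
      ‖omg x‖ ^ 2 := by
    have := integrable_mul_of_continuous_of_hasCompactSupport hNc hcont_pψ hsupp_pψ
    refine this.congr (Eventually.of_forall fun x => ?_)
    simp only; ring
  have i2 : Integrable fun x => ⟪omg x, (Δ omg) x⟫ * ψ t x :=
    integrable_mul_of_continuous_of_hasCompactSupport (hωc.inner (continuous_laplacian hω2)) hψtcont hψtc
  have i3 : Integrable fun x => ⟪omg x, convect (ut t) omg x⟫ * ψ t x :=
    integrable_mul_of_continuous_of_hasCompactSupport
      (hωc.inner ((hω1.continuous_fderiv (by simp)).clm_apply huts.continuous)) hψtcont hψtc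
  have i4 : Integrable fun x => ψ t x * ⟪omg x, fderiv ℝ (ut t) x (omg x)⟫ := by
    have := integrable_mul_of_continuous_of_hasCompactSupport
      (hωc.inner ((hut1.continuous_fderiv (by simp)).clm_apply hωc)) hψtcont hψtc
    exact this.congr (Eventually.of_forall fun x => by simp only; ring)
  -- the two integrations by parts
  have hdivt : ∀ x ∈ tsupport (ψ t), VectorCalculus.divergence (ut t) x = 0 := fun x hx =>
    divergence_cutoff_eq_zero hreg hζ1 hut ht1 (htsupp hx)
  obtain ⟨Cψ, hψL⟩ := hψts.lipschitzWith_of_hasCompactSupport hψtc (by simp)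
  have ibp1 := integral_inner_laplacian_mul_smooth_weight hω2 hψt2 hψtc
  have ibp2 := integral_inner_convect_mul_weight_of_tsupport hω1 hut1 hdivt hψL hψtc
  have hline : ∀ x, lineDeriv ℝ (ψ t) x (ut t x) = fderiv ℝ (ψ t) x (ut t x) := fun x =>
    ((hψts.differentiable (by simp)) x).lineDeriv_eq_fderiv
  simp_rw [hline] at ibp2
  -- integrability of the combinations
  have i23 : Integrable fun x => 2 * (⟪omg x, (Δ omg) x⟫ * ψ t x) - 2 * (⟪omg x, convect (ut t) omg x⟫ * ψ t x) :=
    (i2.const_mul 2).sub (i3.const_mul 2)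
  have i234 : Integrable fun x => 2 * (⟪omg x, (Δ omg) x⟫ * ψ t x) - 2 * (⟪omg x, convect (ut t) omg x⟫ * ψ t x) +
      2 * (ψ t x * ⟪omg x, fderiv ℝ (ut t) x (omg x)⟫) := i23.add (i4.const_mul 2)
  have i2' : Integrable fun x => 2 * (⟪omg x, (Δ omg) x⟫ * ψ t x) := i2.const_mul 2
  have i3' : Integrable fun x => 2 * (⟪omg x, convect (ut t) omg x⟫ * ψ t x) := i3.const_mul 2
  have i4' : Integrable fun x => 2 * (ψ t x * ⟪omg x, fderiv ℝ (ut t) x (omg x)⟫) := i4.const_mul 2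
  -- compact support of the derivatives of `ψ(t)`
  have hoff : ∀ x, x ∉ closedBall (0 : EuclideanSpace ℝ (Fin 3)) (1 / 2) → ψ t =ᶠ[𝓝 x] 0 := by
    intro x hx
    refine notMem_tsupport_iff_eventuallyEq.1 fun h => hx ?_
    exact ball_subset_closedBall (htsupp h)
  have sΔ : HasCompactSupport (Δ (ψ t)) := by
    refine HasCompactSupport.intro (isCompact_closedBall (0 : EuclideanSpace ℝ (Fin 3)) (1 / 2))
      fun x hx => ?_
    rw [(InnerProductSpace.laplacian_congr_nhds (hoff x hx)).eq_of_nhds]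
    have : (Δ (0 : EuclideanSpace ℝ (Fin 3) → ℝ)) x = 0 := by
      rw [show (0 : EuclideanSpace ℝ (Fin 3) → ℝ) = fun _ => 0 from rfl, InnerProductSpace.laplacian_const]
      rfl
    exact this
  have sD : HasCompactSupport fun x => fderiv ℝ (ψ t) x (ut t x) := by
    refine HasCompactSupport.intro (isCompact_closedBall (0 : EuclideanSpace ℝ (Fin 3)) (1 / 2))
      fun x hx => ?_
    have h0 : fderiv ℝ (ψ t) x = 0 := by
      rw [(hoff x hx).fderiv_eq]
      exact fderiv_const_apply 0
    rw [h0]; rfl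
  have iB : Integrable fun x => ‖omg x‖ ^ 2 * (Δ (ψ t)) x :=
    integrable_mul_of_continuous_of_hasCompactSupport hNc (continuous_laplacian hψt2) sΔ
  have iC : Integrable fun x => ‖omg x‖ ^ 2 * fderiv ℝ (ψ t) x (ut t x) :=
    integrable_mul_of_continuous_of_hasCompactSupport hNc
      ((hψts.continuous_fderiv (by simp)).clm_apply huts.continuous) sD
  have iA : Integrable fun x => ‖omg x‖ ^ 2 *
      (-(1 / (2 * c)) * (η (c⁻¹ • x) - fderiv ℝ η (c⁻¹ • x) (c⁻¹ • x))) :=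
    integrable_mul_of_continuous_of_hasCompactSupport hNc hcont_pψ hsupp_pψ
  -- assemble
  simp_rw [hpt, hpt2]
  rw [integral_add i1 i234, integral_add i23 i4', integral_sub i2' i3', integral_const_mul,
    integral_const_mul, integral_const_mul, ibp1, ibp2]
  -- the combined first integral of the target
  have eA : ∫ x, (-(1 / (2 * c)) * (η (c⁻¹ • x) - fderiv ℝ η (c⁻¹ • x) (c⁻¹ • x)) +
        (Δ (ψ t)) x + fderiv ℝ (ψ t) x (ut t x)) * ‖curl (ut t) x‖ ^ 2 =
      (∫ x, ‖omg x‖ ^ 2 * (-(1 / (2 * c)) * (η (c⁻¹ • x) - fderiv ℝ η (c⁻¹ • x) (c⁻¹ • x)))) +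
        (∫ x, ‖omg x‖ ^ 2 * (Δ (ψ t)) x) + ∫ x, ‖omg x‖ ^ 2 * fderiv ℝ (ψ t) x (ut t x) := by
    rw [hωdef]
    have e1 : ∀ x, (-(1 / (2 * c)) * (η (c⁻¹ • x) - fderiv ℝ η (c⁻¹ • x) (c⁻¹ • x)) +
        (Δ (ψ t)) x + fderiv ℝ (ψ t) x (ut t x)) * ‖omg x‖ ^ 2 =
        ‖omg x‖ ^ 2 * (-(1 / (2 * c)) * (η (c⁻¹ • x) - fderiv ℝ η (c⁻¹ • x) (c⁻¹ • x))) +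
          ‖omg x‖ ^ 2 * (Δ (ψ t)) x + ‖omg x‖ ^ 2 * fderiv ℝ (ψ t) x (ut t x) := fun x => by ring
    simp_rw [e1]
    have iAB : Integrable fun x => ‖omg x‖ ^ 2 * (-(1 / (2 * c)) * (η (c⁻¹ • x) - fderiv ℝ η (c⁻¹ • x) (c⁻¹ • x))) +
        ‖omg x‖ ^ 2 * (Δ (ψ t)) x := iA.add iB
    rw [integral_add iAB iC, integral_add iA iB]
  have eI1 : ∫ x, (-(1 / (2 * c)) * (η (c⁻¹ • x) - fderiv ℝ η (c⁻¹ • x) (c⁻¹ • x))) * ‖omg x‖ ^ 2 =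
      ∫ x, ‖omg x‖ ^ 2 * (-(1 / (2 * c)) * (η (c⁻¹ • x) - fderiv ℝ η (c⁻¹ • x) (c⁻¹ • x))) :=
    integral_congr_ae (Eventually.of_forall fun x => mul_comm _ _)
  have eF : ∫ x, frobeniusNormSq (fderiv ℝ omg x) * ψ t x = ∫ x, ψ t x * frobeniusNormSq (fderiv ℝ omg x) :=
    integral_congr_ae (Eventually.of_forall fun x => mul_comm _ _)
  rw [eA, eI1, eF, hωdef]
  ring

end EnstrophyDerivative


section SimilarityForm

-- nested operator types
set_option maxSynthPendingDepth 3

variable {v U : EuclideanSpace ℝ (Fin 3) → EuclideanSpace ℝ (Fin 3)} {c : ℝ}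

/-- `c • c⁻¹ • x = x` — DEPRECATED duplicate of Mathlib's `smul_inv_smul₀` (librarian dedup
2026-08-16, work item dedup-01229): the statement is literally `smul_inv_smul₀ hc x`; kept under its
old name as a one-line alias proof (never deleted), no longer used in this file. [folklore] -/
@[deprecated smul_inv_smul₀ (since := "2026-08-16")]
theorem smul_inv_smul_fin3 (hc : c ≠ 0) (x : EuclideanSpace ℝ (Fin 3)) : c • c⁻¹ • x = x :=
  smul_inv_smul₀ hc x

/-- For the profile `U = c • v(c ·)`: `U(c⁻¹x) = c • v(x)`. [folklore] -/
theorem profile_apply_inv_smul (hc : c ≠ 0) (hU : U = fun y => c • v (c • y))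
    (x : EuclideanSpace ℝ (Fin 3)) : U (c⁻¹ • x) = c • v x := by
  rw [hU]; simp only; rw [smul_inv_smul₀ hc]

/-- For the profile `U = c • v(c ·)`: `curl U(c⁻¹x) = c² • curl v(x)`. [folklore] -/
theorem curl_profile_apply_inv_smul (hc : c ≠ 0) (hU : U = fun y => c • v (c • y))
    (x : EuclideanSpace ℝ (Fin 3)) : curl U (c⁻¹ • x) = c ^ 2 • curl v x := by
  rw [hU, curl_const_smul_comp_smul, smul_inv_smul₀ hc]

/-- For the profile `U = c • v(c ·)`: `D(curl U)(c⁻¹x) = c³ • D(curl v)(x)`. [folklore] -/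
theorem fderiv_curl_profile_apply_inv_smul (hc : c ≠ 0) (hU : U = fun y => c • v (c • y))
    (x : EuclideanSpace ℝ (Fin 3)) : fderiv ℝ (curl U) (c⁻¹ • x) = c ^ 3 • fderiv ℝ (curl v) x := by
  rw [hU, fderiv_curl_smul_comp_smul, smul_inv_smul₀ hc]

/-- For the profile `U = c • v(c ·)`: `DU(c⁻¹x) = c² • Dv(x)`. [folklore] -/
theorem fderiv_profile_apply_inv_smul (hc : c ≠ 0) (hU : U = fun y => c • v (c • y))
    (x : EuclideanSpace ℝ (Fin 3)) : fderiv ℝ U (c⁻¹ • x) = c ^ 2 • fderiv ℝ v x := by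
  rw [hU, fderiv_smul_comp_smul, smul_inv_smul₀ hc]

variable {η : EuclideanSpace ℝ (Fin 3) → ℝ}

/-- **The weighted enstrophy in similarity variables**:
`∫ c η(x/c) |curl v(x)|² dx = ∫ η(y) |curl U(y)|² dy`. [folklore] -/
theorem integral_weight_mul_sq_norm_curl_eq (hc : 0 < c) (hU : U = fun y => c • v (c • y)) :
    ∫ x, (c * η (c⁻¹ • x)) * ‖curl v x‖ ^ 2 = ∫ y, η y * ‖curl U y‖ ^ 2 := by
  have hc0 : c ≠ 0 := hc.ne'
  obtain ⟨H, hH⟩ : ∃ H : EuclideanSpace ℝ (Fin 3) → ℝ,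
      (fun y => c⁻¹ ^ 3 * (η y * ‖curl U y‖ ^ 2)) = H := ⟨_, rfl⟩
  have hpt : ∀ x, (c * η (c⁻¹ • x)) * ‖curl v x‖ ^ 2 = H (c⁻¹ • x) := by
    intro x
    rw [← hH]
    simp only
    rw [curl_profile_apply_inv_smul hc0 hU, norm_smul, mul_pow, Real.norm_eq_abs, sq_abs]
    field_simp
  have e1 : ∫ x, (c * η (c⁻¹ • x)) * ‖curl v x‖ ^ 2 = ∫ x, H (c⁻¹ • x) :=
    integral_congr_ae (Eventually.of_forall hpt)
  have e2 : ∫ y, H y = c⁻¹ ^ 3 * ∫ y, η y * ‖curl U y‖ ^ 2 := by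
    rw [← hH]; exact integral_const_mul _ _
  rw [e1, integral_comp_inv_smul_fin3 H hc, e2, smul_eq_mul, ← mul_assoc,
    show c ^ 3 * c⁻¹ ^ 3 = 1 by field_simp, one_mul]

/-- **The weighted dissipation in similarity variables**:
`∫ c η(x/c) |D(curl v)(x)|²_F dx = c⁻² ∫ η |D(curl U)|²_F`. [folklore] -/
theorem integral_weight_mul_frobeniusNormSq_eq (hc : 0 < c) (hU : U = fun y => c • v (c • y)) :
    ∫ x, (c * η (c⁻¹ • x)) * frobeniusNormSq (fderiv ℝ (curl v) x) =
      c⁻¹ ^ 2 * ∫ y, η y * frobeniusNormSq (fderiv ℝ (curl U) y) := by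
  have hc0 : c ≠ 0 := hc.ne'
  obtain ⟨H, hH⟩ : ∃ H : EuclideanSpace ℝ (Fin 3) → ℝ,
      (fun y => c⁻¹ ^ 5 * (η y * frobeniusNormSq (fderiv ℝ (curl U) y))) = H := ⟨_, rfl⟩
  have hpt : ∀ x, (c * η (c⁻¹ • x)) * frobeniusNormSq (fderiv ℝ (curl v) x) = H (c⁻¹ • x) := by
    intro x
    rw [← hH]
    simp only
    rw [fderiv_curl_profile_apply_inv_smul hc0 hU, frobeniusNormSq_const_smul_fin3]
    field_simp
  have e1 : ∫ x, (c * η (c⁻¹ • x)) * frobeniusNormSq (fderiv ℝ (curl v) x) = ∫ x, H (c⁻¹ • x) :=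
    integral_congr_ae (Eventually.of_forall hpt)
  have e2 : ∫ y, H y = c⁻¹ ^ 5 * ∫ y, η y * frobeniusNormSq (fderiv ℝ (curl U) y) := by
    rw [← hH]; exact integral_const_mul _ _
  rw [e1, integral_comp_inv_smul_fin3 H hc, e2, smul_eq_mul, ← mul_assoc]
  congr 1
  field_simp

/-- **The weighted stretching in similarity variables**:
`∫ c η(x/c) ⟨curl v, Dv (curl v)⟩ dx = c⁻² ∫ η ⟨curl U, DU (curl U)⟩`. [folklore] -/
theorem integral_weight_mul_stretch_eq (hc : 0 < c) (hU : U = fun y => c • v (c • y)) :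
    ∫ x, (c * η (c⁻¹ • x)) * ⟪curl v x, fderiv ℝ v x (curl v x)⟫ =
      c⁻¹ ^ 2 * ∫ y, η y * ⟪curl U y, fderiv ℝ U y (curl U y)⟫ := by
  have hc0 : c ≠ 0 := hc.ne'
  obtain ⟨H, hH⟩ : ∃ H : EuclideanSpace ℝ (Fin 3) → ℝ,
      (fun y => c⁻¹ ^ 5 * (η y * ⟪curl U y, fderiv ℝ U y (curl U y)⟫)) = H := ⟨_, rfl⟩
  have hpt : ∀ x, (c * η (c⁻¹ • x)) * ⟪curl v x, fderiv ℝ v x (curl v x)⟫ = H (c⁻¹ • x) := by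
    intro x
    rw [← hH]
    simp only
    rw [curl_profile_apply_inv_smul hc0 hU, fderiv_profile_apply_inv_smul hc0 hU,
      show (c ^ 2 • fderiv ℝ v x) (c ^ 2 • curl v x) = c ^ 2 • fderiv ℝ v x (c ^ 2 • curl v x) from rfl,
      map_smul, inner_smul_left, inner_smul_right, inner_smul_right]
    simp only [conj_trivial]
    field_simp
  have e1 : ∫ x, (c * η (c⁻¹ • x)) * ⟪curl v x, fderiv ℝ v x (curl v x)⟫ = ∫ x, H (c⁻¹ • x) :=
    integral_congr_ae (Eventually.of_forall hpt)
  have e2 : ∫ y, H y = c⁻¹ ^ 5 * ∫ y, η y * ⟪curl U y, fderiv ℝ U y (curl U y)⟫ := by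
    rw [← hH]; exact integral_const_mul _ _
  rw [e1, integral_comp_inv_smul_fin3 H hc, e2, smul_eq_mul, ← mul_assoc]
  congr 1
  field_simp

/-- **The weight-derivative terms in similarity variables**:
`∫ (∂ₜψ + Δψ + Dψ[v]) |curl v|² dx = c⁻² ∫ (−½η + ½Dη[y] + Δη + Dη[U]) |curl U|² dy`. [folklore] -/
theorem integral_weightDeriv_mul_sq_norm_curl_eq (hc : 0 < c) (hU : U = fun y => c • v (c • y)) :
    ∫ x, (-(1 / (2 * c)) * (η (c⁻¹ • x) - fderiv ℝ η (c⁻¹ • x) (c⁻¹ • x)) +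
        c⁻¹ * (Δ η) (c⁻¹ • x) + fderiv ℝ η (c⁻¹ • x) (v x)) * ‖curl v x‖ ^ 2 =
      c⁻¹ ^ 2 * ∫ y, (-(1 / 2) * η y + 1 / 2 * fderiv ℝ η y y + (Δ η) y + fderiv ℝ η y (U y)) *
        ‖curl U y‖ ^ 2 := by
  have hc0 : c ≠ 0 := hc.ne'
  have hv : ∀ x, v x = c⁻¹ • U (c⁻¹ • x) := fun x => by
    rw [profile_apply_inv_smul hc0 hU, smul_smul, inv_mul_cancel₀ hc0, one_smul]
  obtain ⟨H, hH⟩ : ∃ H : EuclideanSpace ℝ (Fin 3) → ℝ,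
      (fun y => c⁻¹ ^ 5 * ((-(1 / 2) * η y + 1 / 2 * fderiv ℝ η y y + (Δ η) y + fderiv ℝ η y (U y)) *
        ‖curl U y‖ ^ 2)) = H := ⟨_, rfl⟩
  have hpt : ∀ x, (-(1 / (2 * c)) * (η (c⁻¹ • x) - fderiv ℝ η (c⁻¹ • x) (c⁻¹ • x)) +
        c⁻¹ * (Δ η) (c⁻¹ • x) + fderiv ℝ η (c⁻¹ • x) (v x)) * ‖curl v x‖ ^ 2 = H (c⁻¹ • x) := by
    intro x
    have hcurl : curl v x = c⁻¹ ^ 2 • curl U (c⁻¹ • x) := by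
      rw [curl_profile_apply_inv_smul hc0 hU, smul_smul]
      rw [show c⁻¹ ^ 2 * c ^ 2 = 1 by field_simp, one_smul]
    rw [← hH]
    simp only
    rw [hv x, hcurl, norm_smul, mul_pow, Real.norm_eq_abs, sq_abs,
      show fderiv ℝ η (c⁻¹ • x) (c⁻¹ • U (c⁻¹ • x)) = c⁻¹ * fderiv ℝ η (c⁻¹ • x) (U (c⁻¹ • x)) by
        rw [map_smul, smul_eq_mul]]
    field_simp
    ring
  have e1 : ∫ x, (-(1 / (2 * c)) * (η (c⁻¹ • x) - fderiv ℝ η (c⁻¹ • x) (c⁻¹ • x)) +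
        c⁻¹ * (Δ η) (c⁻¹ • x) + fderiv ℝ η (c⁻¹ • x) (v x)) * ‖curl v x‖ ^ 2 = ∫ x, H (c⁻¹ • x) :=
    integral_congr_ae (Eventually.of_forall hpt)
  have e2 : ∫ y, H y = c⁻¹ ^ 5 * ∫ y, (-(1 / 2) * η y + 1 / 2 * fderiv ℝ η y y + (Δ η) y +
      fderiv ℝ η y (U y)) * ‖curl U y‖ ^ 2 := by
    rw [← hH]; exact integral_const_mul _ _
  rw [e1, integral_comp_inv_smul_fin3 H hc, e2, smul_eq_mul, ← mul_assoc]
  congr 1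
  field_simp

end SimilarityForm

end Literature.Analysis.FluidPDE

end
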